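import Mathlib.FieldTheory.IsAlgClosed.AlgebraicClosure
import Mathlib.FieldTheory.Galois.Basic
import HarnessLib
import Summits.ValiantsHypothesis.Statement
import Summits.ValiantsHypothesis.ValiantsHypothesis.Theses.TauConst
import Literature.Computability.AlgebraicComplexity.ValiantConjectureEquivProofs
import Literature.Computability.AlgebraicComplexity.RealTauConjectureDepthFour
import Literature.Computability.AlgebraicComplexity.RazElusiveGeneralRouteProofs
import Summits.ValiantsHypothesis.ValiantsHypothesis.Theorems.AnyonJetsJetConstantElimAlgebraicDescent
import Summits.ValiantsHypothesis.ValiantsHypothesis.Theorems.GaugeDescentScalarRestriction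

/-!
# ValiantsHypothesis / TauConst — the ARITHMETIC-DESCENT column of the constant field, and the
# factorisation of item `TauConstElim` (stmt-ValiantsHypothesis-0335) at the rational notch (kernel)

Decomposition workshop `decomp-valiant`, lens 2 (natural-proofs / succinctness axis), generation 12,
node «ArithmeticDescent».  The properties of the permanent that are known to ESCAPE the
algebraically-natural-proofs barrier (FSV 2018 / GKSS 2017 / CKRST 2020) are arithmetic ones —
heights and denominators of constants, the field the constants generate, reduction modulo primes —
none of them a Zariski-closed condition on coefficient vectors.  Read on the field of CONSTANTS
`ℤ ⊂ ℚ ⊂ ℚ̄ ⊂ ℂ`, Valiant's hypothesis is a monotone column, and this file proves the column and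
cuts it at the rational notch `RatPerHard` (= `VP_ℚ ≠ VNP_ℚ`, `ratPerHard_iff`):

* `vh_iff_algPerHard` — the TOP of the column is free: `VH_ℂ ⟺ VH_ℚ̄` (down: the tree's
  `AnyonJets.JetConstantElim.stub_algebraicDescent` = BCS (4.17)(2) autarky; up: base change);
* `ratPerHard_of_vh`, `tauPerHard_of_ratPerHard` — `VH_ℂ ⟹ VH_ℚ ⟹ τ(per)` not p-bounded;
* `summit_iff_split` — the exact AND-node `VH ⟺ TauPerHard ∧ HeightLift ∧ Descent` with
  `HeightLift := TauPerHard → RatPerHard` (heights / denominators: "rational constants of a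
  polynomial-size circuit for `per_n` can be removed") and `Descent := RatPerHard → VH`
  (irrationality: "collapse over `ℚ̄` descends to `ℚ`"); `vh_of_pieces` is the node's deciding implication;
* `residual_iff_tauConstElim` — the residual `HeightLift ∧ Descent` IS route `TauConst`'s item
  `TauConstElim` (stmt-ValiantsHypothesis-0335), literally, now FACTORED at `VH_ℚ` into a pure height
  statement and a pure degree statement;
* `descent_iff`, `finiteDescent_holds`, `degreeDescent_iff_descent` — the degree factor is EXACTLY
  "`per` p-computable over `ℚ̄` ⟹ p-computable over number fields `K_n ⊂ ℚ̄` of p-bounded degree"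
  (`DegreeDescent`): restriction of scalars from p-bounded degree to `ℚ` is a theorem here
  (`finiteDescent_holds`, via the tree's proved `GaugeDescent.ScalarRestriction`), so
  `VH ⟺ TauPerHard ∧ HeightLift ∧ DegreeDescent` (`summit_iff_split_degree`).

Status of the pieces (evidence, source-labelled): `TauPerHard` and `RatPerHard` are implied by
`VH` (kernel) and NOT known to imply it — "it seems difficult to rule out the possibility that …
the permanent … does not lie in VP⁰ but is still computable by polynomial-size arithmetic circuits
using integer constants of exponential bit size" [KoiranPerifel2011, Rem. 4 = arXiv:0710.0360 p. 8];
"VP_ℂ ≠ VNP_ℂ ⟹ VP⁰ ≠ VNP⁰ is trivial, the converse is unclear" [arXiv:2606.25121, p. 3].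
Bürgisser's autarky needs an algebraically closed BASE field [BurgisserClausenShokrollahi1997,
Thm. (4.17)(2) p. 155 and Ex. 4.5 p. 163], which is why "the truth of `VP^F ≠ VNP^F` only depends on
the characteristic" [Burgisser2024 = arXiv:2406.06217, Rem. 2.26(2)] is the statement for
algebraically closed fields / the upward direction (`isPComputable_perPoly_map`): the single-field
descent `ℚ̄ → ℚ` (`Descent`, equivalently `DegreeDescent`) is open, cf. route `GaugeDescent`
(`GeomRigidity`, `TorusOrbitDescent`) and Bürgisser's GRH-conditional Boolean transfer.

HONEST FRAMING: nothing here is progress on `VP ≠ VNP`; the file places three OPEN statements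
(`TauPerHard`, `HeightLift`, `Descent`/`DegreeDescent`) exactly, proves the arrows between them and
the summit that ARE provable, and identifies the workshop node's residual with an existing item.
All theorems are sorry-free.
-/

noncomputable section
set_option linter.dupNamespace false

open MvPolynomial
open Literature.Computability.AlgebraicComplexity

namespace Summit.ValiantsHypothesis.ValiantsHypothesis.Theorems.ArithmeticDescent

/-! ### The pieces -/

/-- target · notch (rank 0) · COSTUME-ADJACENT BY DESIGN (it is `VP_ℚ ≠ VNP_ℚ`, kernel `ratPerHard_iff`;
S ⟹ it by `ratPerHard_of_vh`; NOT known to imply S — that gap is the piece `Descent`).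
The permanent family is not p-computable by circuits with RATIONAL constants.
(ref: Burgisser2000, Ch. 2 and §4.1) -/
def RatPerHard : Prop := ¬ IsPComputable (fun n => perPoly (Fin n) ℚ)

/-- support · the algebraic notch: the permanent is not p-computable over `ℚ̄`.  EQUIVALENT to S
(kernel `vh_iff_algPerHard`: Lefschetz/autarky down, base change up) — recorded only to show that
`Descent` is a pure `ℚ̄ → ℚ` (degree) statement. (ref: BurgisserClausenShokrollahi1997, Thm. (4.17)(2)) -/
def AlgPerHard : Prop := ¬ IsPComputable (fun n => perPoly (Fin n) (AlgebraicClosure ℚ))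

/-- crux (rank 2) · WEAKER · ATTACKABLE.  The constant-free (τ-) complexity of the integer permanent
is not p-bounded: `VP⁰`-hardness of `per`.  S ⟹ it (kernel `tauPerHard_of_vh`); converse open in
print ([corpus:arxiv-1307.3863 p.17 = Mahajan2014 §5], [corpus:arxiv-2606.25121 p.3]).  Why it might fail: it does not
fail short of ¬S — but every known route to it (τ-conjecture, real τ-conjecture) is itself open.
(real τ-conjecture: Koiran2011; tree `RealTauConjectureDepthFour`). (ref: Burgisser2000, §4.1) -/
def TauPerHard : Prop := ¬ IsPBounded (fun n => constantFreeComplexity (perPoly (Fin n) ℤ))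

/-- crux (rank 3) · DECLARED RESIDUAL factor 1 (heights) · IDEA-NEEDED.  Polynomial-size circuits
for `per_n` with rational constants can be replaced by constant-free ones: `TauPerHard → RatPerHard`.
First rung in the tree: `exists_integralMultiple_of_numberField_circuit` (bounded heights, up to an
integer multiplier).  Why it might fail: rational constants of super-polynomial height (e.g. `2^(2^n)`,
`1/n!!…`) may be essential; no height bound for optimal circuits is known. (ref: KoiranPerifel2011, Rem. 4) -/
def HeightLift : Prop := TauPerHard → RatPerHard

/-- crux (rank 4) · DECLARED RESIDUAL factor 2 (irrationality / Galois descent) · IDEA-NEEDED.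
`VP_ℚ ≠ VNP_ℚ ⟹ VP_ℂ ≠ VNP_ℂ`; by `descent_iff` exactly `RatPerHard → AlgPerHard`, i.e. collapse over
`ℚ̄` descends to `ℚ`.  Levers: route `GaugeDescent` (`GeomRigidity ∧ TorusOrbitDescent` ⟹ number field
of p-bounded degree) + `FiniteDescent` below.  Why it might fail: optimal `ℚ̄`-circuits for `per_n`
might need number fields of super-polynomial degree (autarky fails for non-closed base fields,
BCS Ex. 4.5). (ref: BurgisserClausenShokrollahi1997, Thm. (4.17) and Ex. 4.5) -/
def Descent : Prop := RatPerHard → ValiantsHypothesis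

/-- The three pieces give the summit (the workshop node's deciding theorem `closes`). [folklore] -/
theorem vh_of_pieces (hT : TauPerHard) (hH : HeightLift) (hD : Descent) : ValiantsHypothesis :=
  hD (hH hT)

/-! ### Base change along the constants column (all kernel) -/

/-- p-computability of the permanent family ascends along any ring homomorphism of constant fields
(extension of scalars is free). [cite: Burgisser2000, §4.1] -/
theorem isPComputable_perPoly_map {k k' : Type} [Field k] [Field k'] (φ : k →+* k')
    (h : IsPComputable (fun n => perPoly (Fin n) k)) :
    IsPComputable (fun n => perPoly (Fin n) k') := by
  obtain ⟨c, hc⟩ := h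
  refine ⟨c, fun n => ?_⟩
  have hle := ArithCircuit.complexity_map_le φ (perPoly (Fin n) k)
  rw [map_perPoly] at hle
  exact hle.trans (hc n)

/-- The summit in per-family form. [cite: Vonzurgathen1987Feasible, Prop. 4.8] -/
theorem vh_iff_perHard : ValiantsHypothesis ↔ ¬ IsPComputable (fun n => perPoly (Fin n) ℂ) :=
  perNotPComputableComplex_iff_holds.symm

/-- The notch is Valiant's hypothesis over `ℚ`. [cite: Vonzurgathen1987Feasible, Prop. 4.8] -/
theorem ratPerHard_iff : RatPerHard ↔ Literature.PNP.ValiantHypothesis ℚ :=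
  not_congr (isPComputable_perPoly_iff_VP_eq_VNP ℚ (by rw [ringChar.eq_zero]; decide))

/-- The algebraic notch is Valiant's hypothesis over `ℚ̄`. [cite: Vonzurgathen1987Feasible, Prop. 4.8] -/
theorem algPerHard_iff : AlgPerHard ↔ Literature.PNP.ValiantHypothesis (AlgebraicClosure ℚ) :=
  not_congr (isPComputable_perPoly_iff_VP_eq_VNP (AlgebraicClosure ℚ)
    (by rw [ringChar.eq_zero]; decide))

/-- S ⟹ notch: a rational circuit is a complex circuit. [cite: Burgisser2000, §4.1] -/
theorem ratPerHard_of_vh (h : ValiantsHypothesis) : RatPerHard := fun hQ =>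
  vh_iff_perHard.1 h (isPComputable_perPoly_map (algebraMap ℚ ℂ) hQ)

/-- notch ⟹ `TauPerHard`: a constant-free circuit is a rational circuit. [cite: Burgisser2000, §4.1] -/
theorem tauPerHard_of_ratPerHard (h : RatPerHard) : TauPerHard := fun hτ => by
  obtain ⟨c, hc⟩ := hτ
  refine h ⟨c, fun n => ?_⟩
  have hle := ArithCircuit.complexity_map_le_constantFreeComplexity (Int.castRingHom ℚ)
    (perPoly (Fin n) ℤ)
  rw [map_perPoly] at hle
  exact hle.trans (hc n)

/-- S ⟹ `TauPerHard`. [cite: Burgisser2000, §4.1] -/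
theorem tauPerHard_of_vh (h : ValiantsHypothesis) : TauPerHard :=
  tauPerHard_of_ratPerHard (ratPerHard_of_vh h)

/-- **The top of the column is free**: `VH_ℚ̄ ⟺ VH_ℂ` (down: an optimal `ℂ`-circuit for the integer
polynomial `per_n` has a `ℚ̄`-twin of the same size, tree `stub_algebraicDescent` = BCS (4.17)(2);
up: base change along `ℚ̄ ↪ ℂ`). [cite: BurgisserClausenShokrollahi1997, Thm. (4.17)(2)] -/
theorem vh_iff_algPerHard : ValiantsHypothesis ↔ AlgPerHard := by
  rw [vh_iff_perHard]
  unfold AlgPerHard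
  refine not_congr ⟨fun h => ?_, fun h => ?_⟩
  · obtain ⟨c, hc⟩ := h
    refine ⟨c, fun n => ?_⟩
    obtain ⟨Q, hQ2, hQc, hQs⟩ :=
      Summit.ValiantsHypothesis.ValiantsHypothesis.Theorems.AnyonJets.JetConstantElim.stub_algebraicDescent
        (Fin n × Fin n) (perPoly (Fin n) ℤ)
    rw [map_perPoly] at hQc hQs
    exact (ArithCircuit.complexity_le_size hQ2 hQc).trans (hQs.trans (hc n))
  · haveI : IsGalois ℚ (AlgebraicClosure ℚ) :=
      @IsAlgClosure.isGalois ℚ (AlgebraicClosure ℚ) _ _ (AlgebraicClosure.instAlgebra ℚ) inferInstance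
        inferInstance
    let ι : AlgebraicClosure ℚ →ₐ[ℚ] ℂ := IsAlgClosed.lift
    exact isPComputable_perPoly_map ι.toRingHom h

/-- Hence `Descent` is a pure `ℚ̄ → ℚ` statement. [cite: BurgisserClausenShokrollahi1997, Thm. (4.17)(2)] -/
theorem descent_iff : Descent ↔ (RatPerHard → AlgPerHard) := by
  simp only [Descent, vh_iff_algPerHard]

/-! ### The node: exact AND, S ⟹ each piece, residual accounting -/

/-- **Exact AND-node**: `VH ⟺ TauPerHard ∧ HeightLift ∧ Descent`. [folklore] -/
theorem summit_iff_split : ValiantsHypothesis ↔ TauPerHard ∧ HeightLift ∧ Descent :=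
  ⟨fun h => ⟨tauPerHard_of_vh h, fun _ => ratPerHard_of_vh h, fun _ => h⟩,
    fun h => vh_of_pieces h.1 h.2.1 h.2.2⟩

/-- The two-piece form at the notch: `VH ⟺ VH_ℚ ∧ Descent`. [folklore] -/
theorem summit_iff_pair : ValiantsHypothesis ↔ RatPerHard ∧ Descent :=
  ⟨fun h => ⟨ratPerHard_of_vh h, fun _ => h⟩, fun h => h.2 h.1⟩

/-- `TauConstElim` is the implication `TauPerHard → VH`. [folklore] -/
theorem tauConstElim_iff :
    Summit.ValiantsHypothesis.ValiantsHypothesis.Theses.TauConst.TauConstElim ↔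
      (TauPerHard → ValiantsHypothesis) := by
  constructor
  · intro hE hT hEq
    exact hT (hE hEq)
  · intro hTV hEq
    by_contra hτ
    exact hTV hτ hEq

/-- **LESSON-3 accounting**: the residual of this node is EXACTLY route `TauConst`'s item
`TauConstElim` (stmt-ValiantsHypothesis-0335), now factored at the notch `VH_ℚ` into a height
statement and a degree statement. [folklore] -/
theorem residual_iff_tauConstElim :
    (HeightLift ∧ Descent) ↔ Summit.ValiantsHypothesis.ValiantsHypothesis.Theses.TauConst.TauConstElim := by
  rw [tauConstElim_iff]
  constructor
  · rintro ⟨hH, hD⟩ hT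
    exact hD (hH hT)
  · intro h
    exact ⟨fun hT => ratPerHard_of_vh (h hT), fun hR => h (tauPerHard_of_ratPerHard hR)⟩

/-! ### Typed sub-split of `Descent` (second layer, not items): degree bound + restriction of scalars -/

/-- support · UNDECIDED (test: route `GaugeDescent`, cruxes `GeomRigidity` ∧ `TorusOrbitDescent`).
If the permanent is p-computable over `ℚ̄`, then already over number fields `K_n ⊂ ℚ̄` of p-bounded
degree.  (Vacuous under S; S-implied.)  Why it might fail: the field of definition of an optimal
circuit is controlled by nothing we know; BCS Ex. 4.5 shows degree can be forced up in general.
(ref: BurgisserClausenShokrollahi1997, Ex. 4.5) -/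
def DegreeDescent : Prop :=
  IsPComputable (fun n => perPoly (Fin n) (AlgebraicClosure ℚ)) →
    ∃ (K : ℕ → IntermediateField ℚ (AlgebraicClosure ℚ)) (d : ℕ → ℕ), IsPBounded d ∧
      (∀ n, FiniteDimensional ℚ (K n) ∧ Module.finrank ℚ (K n) ≤ d n) ∧
      IsPBounded (fun n => complexity (perPoly (Fin n) (K n)))

/-- support · THEOREM (kernel: `finiteDescent_holds` below; simulate each `K_n`-gate by `d_n` rational
coordinate gates w.r.t. a `ℚ`-basis of `K_n` — structure constants are rational CONSTANTS, so heights
are irrelevant over `ℚ` — and read off the coordinate of `1`; size `O(d_n³ · s_n)`).  Restriction of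
scalars from number fields of p-bounded degree to `ℚ`.
(ref: BurgisserClausenShokrollahi1997, (4.15)) -/
def FiniteDescent : Prop :=
  ∀ (K : ℕ → IntermediateField ℚ (AlgebraicClosure ℚ)) (d : ℕ → ℕ), IsPBounded d →
    (∀ n, FiniteDimensional ℚ (K n) ∧ Module.finrank ℚ (K n) ≤ d n) →
    IsPBounded (fun n => complexity (perPoly (Fin n) (K n))) →
    IsPComputable (fun n => perPoly (Fin n) ℚ)

/-- Glue of the sub-split: `DegreeDescent → FiniteDescent → Descent`. [folklore] -/
theorem descent_of_degreeDescent (hDeg : DegreeDescent) (hFin : FiniteDescent) : Descent := by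
  rw [descent_iff]
  intro hR hA
  obtain ⟨K, d, hd, hK, hc⟩ := hDeg hA
  exact hR (hFin K d hd hK hc)

/-- S makes `DegreeDescent` vacuously true (so it is S-implied, as the doctrine requires). [folklore] -/
theorem degreeDescent_of_vh (h : ValiantsHypothesis) : DegreeDescent := fun hA =>
  absurd hA (vh_iff_algPerHard.1 h)

/-- **`FiniteDescent` HOLDS** (kernel): restriction of scalars from a number field of degree `d_n`
to `ℚ` costs a factor `c·d_n³` — the tree's proved item `GaugeDescent.ScalarRestriction`
(stmt-ValiantsHypothesis-6636, `scalarRestriction_proof`) applied to `per_n ∈ ℚ[x]`.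
[cite: BurgisserClausenShokrollahi1997, (4.15)] -/
theorem finiteDescent_holds : FiniteDescent := by
  intro K d hd hK hc
  obtain ⟨c₀, hc₀⟩ :=
    Summit.ValiantsHypothesis.ValiantsHypothesis.Theorems.GaugeDescent.scalarRestriction_proof
  have hle : ∀ n, complexity (perPoly (Fin n) ℚ) ≤
      c₀ * d n ^ 3 * complexity (perPoly (Fin n) (K n)) := by
    intro n
    haveI : FiniteDimensional ℚ (K n) := (hK n).1
    have h := hc₀ ℚ (K n) (Fin n × Fin n) (perPoly (Fin n) ℚ)
    rw [map_perPoly] at h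
    refine h.trans ?_
    gcongr
    exact (hK n).2
  exact IsPBounded.mono (IsPBounded.mul_holds (IsPBounded.mul_holds (IsPBounded.const c₀)
    (IsPBounded.pow_holds hd 3)) hc) hle

/-- Hence factor 2 is EXACTLY the degree statement: `DegreeDescent ⟺ Descent`. [folklore] -/
theorem degreeDescent_iff_descent : DegreeDescent ↔ Descent := by
  refine ⟨fun h => descent_of_degreeDescent h finiteDescent_holds, fun hD hA => ?_⟩
  have hQ : IsPComputable (fun n => perPoly (Fin n) ℚ) := by
    by_contra hR
    exact (descent_iff.1 hD hR) hA
  refine ⟨fun _ => ⊥, fun _ => 1, IsPBounded.const 1, fun n => ⟨?_, ?_⟩, ?_⟩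
  · exact Module.finite_of_finrank_pos (by rw [IntermediateField.finrank_bot]; exact Nat.one_pos)
  · rw [IntermediateField.finrank_bot]
  · exact isPComputable_perPoly_map
      (algebraMap ℚ (⊥ : IntermediateField ℚ (AlgebraicClosure ℚ))) hQ

/-- **The node with the sharpened factor 2**: `VH ⟺ TauPerHard ∧ HeightLift ∧ DegreeDescent`
(glue through the kernel theorem `finiteDescent_holds`). [folklore] -/
theorem summit_iff_split_degree : ValiantsHypothesis ↔ TauPerHard ∧ HeightLift ∧ DegreeDescent :=
  ⟨fun h => ⟨tauPerHard_of_vh h, fun _ => ratPerHard_of_vh h, degreeDescent_of_vh h⟩,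
    fun h => vh_of_pieces h.1 h.2.1 (descent_of_degreeDescent h.2.2 finiteDescent_holds)⟩

end Summit.ValiantsHypothesis.ValiantsHypothesis.Theorems.ArithmeticDescent
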